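import Mathlib
import Summits.AtomisticToContinuum.Crystallization.Theorems.GappedShellCensusCleanLimitsHaveWindowsLayeredInplaneStep

/-!
# Exactly layered shells ⇒ exactly layered set, file 5: the first complete layer

Crux `GappedShellCensus.CleanLimitsHaveWindows` (stmt-AtomisticToContinuum-15932), line `Sketch`, support for
`stub_layeredOfExactShells`.  Anchor `stub_firstLayer`: a non-empty set with the gap clause all of whose bond shells
are exact slot models contains a complete triangular layer `p₀ + A (ℤ u + ℤ v)` of spacing `a' ∈ [0.98a, 1.02a]`.
Either some site is RIGID (hexagonal type, or cubic with not both heights ideal): walk in its plane with the in-plane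
step (`inplaneStep_of_type`), which reproduces frame, type and heights, hence rigidity; or EVERY shell is a perfect
cuboctahedron: walk with `stub_cuboctStep`.  The four directions `±u, ±v` are the direction `u` of the re-framed
models `A ∘ σ` for the two mirror symmetries `σ_u : u ↦ -u, v ↦ v - u` and `σ_uv : u ↔ v` of both slot models
(`la_range_mirror`, code permutations by `decide`).
-/

noncomputable section

namespace Summit.AtomisticToContinuum.Crystallization.Theorems.CleanHull

open Literature.MathematicalPhysics.StatisticalMechanics

/-! ## The two mirrors of the slot models -/

/-- The mirror `σ_u` (reflection in the plane `u^⊥`): `u ↦ -u`, `v ↦ v - u`, `e₃ ↦ e₃`. [folklore] -/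
def laMirU (a' : ℝ) : EuclideanSpace ℝ (Fin 3) ≃ₗᵢ[ℝ] EuclideanSpace ℝ (Fin 3) :=
  (ℝ ∙ (triangularVec₁ a' : EuclideanSpace ℝ (Fin 3)))ᗮ.reflection

/-- The mirror `σ_uv` (reflection in the plane `(u - v)^⊥`): `u ↔ v`, `e₃ ↦ e₃`. [folklore] -/
def laMirUV (a' : ℝ) : EuclideanSpace ℝ (Fin 3) ≃ₗᵢ[ℝ] EuclideanSpace ℝ (Fin 3) :=
  (ℝ ∙ (triangularVec₁ a' - triangularVec₂ a' : EuclideanSpace ℝ (Fin 3)))ᗮ.reflection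

/-- The values of the two mirrors on `u, v, e₃`. [folklore] -/
theorem laMir_basis {a' : ℝ} (ha' : 0 < a') :
    (laMirU a' (triangularVec₁ a') = -triangularVec₁ a' ∧
      laMirU a' (triangularVec₂ a') = triangularVec₂ a' - triangularVec₁ a' ∧ laMirU a' (layerNormal 1) = layerNormal 1) ∧
    (laMirUV a' (triangularVec₁ a') = triangularVec₂ a' ∧ laMirUV a' (triangularVec₂ a') = triangularVec₁ a' ∧
      laMirUV a' (layerNormal 1) = layerNormal 1) := by
  have h3 : Real.sqrt 3 ^ 2 = 3 := Real.sq_sqrt (by norm_num)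
  have fixU : ∀ x : EuclideanSpace ℝ (Fin 3), inner ℝ (triangularVec₁ a') x = 0 → laMirU a' x = x := fun x hx =>
    Submodule.reflection_mem_subspace_eq_self ((Submodule.mem_orthogonal_singleton_iff_inner_right).2 hx)
  have fixUV : ∀ x : EuclideanSpace ℝ (Fin 3), inner ℝ (triangularVec₁ a' - triangularVec₂ a') x = 0 →
      laMirUV a' x = x := fun x hx =>
    Submodule.reflection_mem_subspace_eq_self ((Submodule.mem_orthogonal_singleton_iff_inner_right).2 hx)
  have u1 : laMirU a' (triangularVec₁ a') = -triangularVec₁ a' := Submodule.reflection_orthogonalComplement_singleton_eq_neg _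
  have e1 : laMirU a' (layerNormal 1) = layerNormal 1 :=
    fixU _ (by simp [EuclideanSpace.inner_eq_star_dotProduct, dotProduct, Fin.sum_univ_three, triangularVec₁, layerNormal])
  have v1 : laMirU a' (triangularVec₂ a') = triangularVec₂ a' - triangularVec₁ a' := by
    have hperp : laMirU a' (triangularVec₂ a' - (1 / 2 : ℝ) • triangularVec₁ a') =
        triangularVec₂ a' - (1 / 2 : ℝ) • triangularVec₁ a' :=
      fixU _ (by
        simp [EuclideanSpace.inner_eq_star_dotProduct, dotProduct, Fin.sum_univ_three, triangularVec₁, triangularVec₂]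
        left; ring)
    have e : triangularVec₂ a' = (triangularVec₂ a' - (1 / 2 : ℝ) • triangularVec₁ a') + (1 / 2 : ℝ) • triangularVec₁ a' := by
      module
    conv_lhs => rw [e, map_add, map_smul, hperp, u1]
    module
  obtain ⟨nu, nv, -⟩ := la_norm_uv ha'
  have uv1 : laMirUV a' (triangularVec₁ a') = triangularVec₂ a' := Submodule.reflection_sub (by rw [nu, nv])
  have uv2 : laMirUV a' (triangularVec₂ a') = triangularVec₁ a' := by
    conv_lhs => rw [← uv1]
    exact Submodule.reflection_reflection _ _
  have uve : laMirUV a' (layerNormal 1) = layerNormal 1 :=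
    fixUV _ (by
      simp [EuclideanSpace.inner_eq_star_dotProduct, dotProduct, Fin.sum_univ_three, triangularVec₁, triangularVec₂,
        layerNormal])
  exact ⟨⟨u1, v1, e1⟩, ⟨uv1, uv2, uve⟩⟩

/-- The two mirrors on codes. [folklore] -/
def laMirCode (s : Bool) (c : ℤ × ℤ × ℤ) : ℤ × ℤ × ℤ := if s then (-c.1 - c.2.1, c.2.1, c.2.2) else (c.2.1, c.1, c.2.2)

/-- **Both mirrors permute both code sets.** [folklore] -/
theorem laMirCode_perm (s t : Bool) :
    (∀ m : Fin 12, ∃ m' : Fin 12, laMirCode s (laCode t m) = laCode t m') ∧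
      (∀ m' : Fin 12, ∃ m : Fin 12, laMirCode s (laCode t m) = laCode t m') := by
  revert s t; decide

/-- The two mirrors on code points. [folklore] -/
theorem laMir_laPt {a' : ℝ} (ha' : 0 < a') (kp km : ℝ) (c : ℤ × ℤ × ℤ) :
    laMirU a' (laPt a' kp km c) = laPt a' kp km (laMirCode true c) ∧
      laMirUV a' (laPt a' kp km c) = laPt a' kp km (laMirCode false c) := by
  obtain ⟨⟨u1, v1, e1⟩, ⟨uv1, uv2, uve⟩⟩ := laMir_basis ha'
  constructor <;> simp only [laPt, laMirCode, map_add, map_smul, u1, v1, e1, uv1, uv2, uve, Int.cast_sub, Int.cast_neg,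
    if_true, if_false, Bool.false_eq_true] <;> module

/-- **Re-framing by a mirror does not change the shell.** [folklore] -/
theorem la_range_mirror {a' : ℝ} (ha' : 0 < a') (s t : Bool) (kp km : ℝ) (x : EuclideanSpace ℝ (Fin 3))
    (A : EuclideanSpace ℝ (Fin 3) →ₗᵢ[ℝ] EuclideanSpace ℝ (Fin 3)) :
    (Set.range fun k : Fin 12 => x + (A.comp (if s then laMirU a' else laMirUV a').toLinearIsometry) (laSlot t a' kp km k)) =
      Set.range fun k : Fin 12 => x + A (laSlot t a' kp km k) := by
  obtain ⟨fwd, bwd⟩ := laMirCode_perm s t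
  have key : ∀ k, (A.comp (if s then laMirU a' else laMirUV a').toLinearIsometry) (laSlot t a' kp km k) =
      A (laPt a' kp km (laMirCode s (laCode t k))) := by
    intro k
    rw [laSlot_eq_laPt, LinearIsometry.coe_comp, Function.comp_apply, LinearIsometryEquiv.coe_toLinearIsometry]
    cases s
    · rw [if_neg Bool.false_ne_true, (laMir_laPt ha' kp km _).2]
    · rw [if_pos rfl, (laMir_laPt ha' kp km _).1]
  ext y
  simp only [Set.mem_range]
  constructor
  · rintro ⟨k, rfl⟩; obtain ⟨k', hk'⟩ := fwd k; exact ⟨k', by rw [key, hk', laSlot_eq_laPt]⟩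
  · rintro ⟨k', rfl⟩; obtain ⟨k, hk⟩ := bwd k'; exact ⟨k, by rw [key, hk, laSlot_eq_laPt]⟩

/-! ## Walking in the plane -/

/-- **Walking.** If the direction-`u` step is available in EVERY frame (reproducing type and heights), then from
one site with shell `p + A·slot_t` the whole lattice `p + A (ℤ u + ℤ v)` is in `Z`. [folklore] -/
theorem la_walk (Z : Set (EuclideanSpace ℝ (Fin 3))) (a a' kp km : ℝ) (ha' : 0 < a') (t : Bool)
    (STEP : ∀ (x : EuclideanSpace ℝ (Fin 3)) (F : EuclideanSpace ℝ (Fin 3) →ₗᵢ[ℝ] EuclideanSpace ℝ (Fin 3)),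
      x ∈ Z → (bondShell a Z x = Set.range fun k : Fin 12 => x + F (laSlot t a' kp km k)) →
      bondShell a Z (x + F (triangularVec₁ a')) =
        Set.range fun k : Fin 12 => x + F (triangularVec₁ a') + F (laSlot t a' kp km k))
    (A : EuclideanSpace ℝ (Fin 3) →ₗᵢ[ℝ] EuclideanSpace ℝ (Fin 3)) (p : EuclideanSpace ℝ (Fin 3)) (hp : p ∈ Z)
    (hS : bondShell a Z p = Set.range fun k : Fin 12 => p + A (laSlot t a' kp km k)) :
    ∀ i j : ℤ, p + A ((i : ℝ) • triangularVec₁ a' + (j : ℝ) • triangularVec₂ a') ∈ Z := by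
  -- the invariant and the four moves
  let Q : EuclideanSpace ℝ (Fin 3) → Prop := fun x =>
    x ∈ Z ∧ bondShell a Z x = Set.range fun k : Fin 12 => x + A (laSlot t a' kp km k)
  have slot01 : laSlot t a' kp km 0 = triangularVec₁ a' ∧ laSlot t a' kp km 1 = -triangularVec₁ a' ∧
      laSlot t a' kp km 2 = triangularVec₂ a' ∧ laSlot t a' kp km 3 = -triangularVec₂ a' := by
    cases t <;> simp [laSlot, slotC, slotH]
  have memZ : ∀ x, Q x → ∀ k, x + A (laSlot t a' kp km k) ∈ Z := fun x hx k => by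
    have h : x + A (laSlot t a' kp km k) ∈ bondShell a Z x := hx.2 ▸ ⟨k, rfl⟩
    exact h.1
  obtain ⟨⟨u1, -, -⟩, ⟨uv1, -, -⟩⟩ := laMir_basis ha'
  have move : ∀ x, Q x → ∀ d : EuclideanSpace ℝ (Fin 3),
      (∃ F : EuclideanSpace ℝ (Fin 3) →ₗᵢ[ℝ] EuclideanSpace ℝ (Fin 3), F (triangularVec₁ a') = A d ∧
        ∀ y, (Set.range fun k : Fin 12 => y + F (laSlot t a' kp km k)) =
          Set.range fun k : Fin 12 => y + A (laSlot t a' kp km k)) →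
      (∃ k, laSlot t a' kp km k = d) → Q (x + A d) := by
    rintro x hx d ⟨F, hFu, hF⟩ ⟨k, hk⟩
    refine ⟨hk ▸ memZ x hx k, ?_⟩
    have h := STEP x F hx.1 (by rw [hF]; exact hx.2)
    rw [hFu, hF] at h
    exact h
  have FU : ∃ F : EuclideanSpace ℝ (Fin 3) →ₗᵢ[ℝ] EuclideanSpace ℝ (Fin 3), F (triangularVec₁ a') = A (triangularVec₁ a') ∧
      ∀ y, (Set.range fun k : Fin 12 => y + F (laSlot t a' kp km k)) = Set.range fun k : Fin 12 => y + A (laSlot t a' kp km k) :=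
    ⟨A, rfl, fun y => rfl⟩
  have FmU : ∃ F : EuclideanSpace ℝ (Fin 3) →ₗᵢ[ℝ] EuclideanSpace ℝ (Fin 3), F (triangularVec₁ a') = A (-triangularVec₁ a') ∧
      ∀ y, (Set.range fun k : Fin 12 => y + F (laSlot t a' kp km k)) = Set.range fun k : Fin 12 => y + A (laSlot t a' kp km k) :=
    ⟨A.comp (laMirU a').toLinearIsometry, by simp [u1], fun y => by simpa using la_range_mirror ha' true t kp km y A⟩
  have FV : ∃ F : EuclideanSpace ℝ (Fin 3) →ₗᵢ[ℝ] EuclideanSpace ℝ (Fin 3), F (triangularVec₁ a') = A (triangularVec₂ a') ∧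
      ∀ y, (Set.range fun k : Fin 12 => y + F (laSlot t a' kp km k)) = Set.range fun k : Fin 12 => y + A (laSlot t a' kp km k) :=
    ⟨A.comp (laMirUV a').toLinearIsometry, by simp [uv1], fun y => by simpa using la_range_mirror ha' false t kp km y A⟩
  have FmV : ∃ F : EuclideanSpace ℝ (Fin 3) →ₗᵢ[ℝ] EuclideanSpace ℝ (Fin 3), F (triangularVec₁ a') = A (-triangularVec₂ a') ∧
      ∀ y, (Set.range fun k : Fin 12 => y + F (laSlot t a' kp km k)) = Set.range fun k : Fin 12 => y + A (laSlot t a' kp km k) := by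
    refine ⟨(A.comp (laMirUV a').toLinearIsometry).comp (laMirU a').toLinearIsometry, by simp [u1, uv1], fun y => ?_⟩
    have h1 := la_range_mirror ha' true t kp km y (A.comp (laMirUV a').toLinearIsometry)
    have h2 := la_range_mirror ha' false t kp km y A
    simp only [if_true, if_false, Bool.false_eq_true] at h1 h2
    rw [h1, h2]
  -- induction along `u`, then along `v`
  have hQ0 : Q p := ⟨hp, hS⟩
  have lineU : ∀ i : ℤ, Q (p + A ((i : ℝ) • triangularVec₁ a')) := by
    intro i
    induction i using Int.induction_on with
    | zero => simpa using hQ0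
    | succ n ih =>
      have := move _ ih (triangularVec₁ a') FU ⟨0, slot01.1⟩
      rw [add_assoc, ← map_add] at this
      convert this using 3; push_cast; module
    | pred n ih =>
      have := move _ ih (-triangularVec₁ a') FmU ⟨1, slot01.2.1⟩
      rw [add_assoc, ← map_add] at this
      convert this using 3; push_cast; module
  intro i j
  suffices h : Q (p + A ((i : ℝ) • triangularVec₁ a' + (j : ℝ) • triangularVec₂ a')) from h.1
  induction j using Int.induction_on with
  | zero => simpa using lineU i
  | succ n ih =>
    have := move _ ih (triangularVec₂ a') FV ⟨2, slot01.2.2.1⟩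
    rw [add_assoc, ← map_add] at this
    convert this using 3; push_cast; module
  | pred n ih =>
    have := move _ ih (-triangularVec₂ a') FmV ⟨3, slot01.2.2.2⟩
    rw [add_assoc, ← map_add] at this
    convert this using 3; push_cast; module

/-! ## The anchor -/

/-- **First complete layer.** A non-empty set with the gap clause at scale `a` all of whose bond shells are exact
slot models contains a complete triangular layer `p₀ + A (ℤ u + ℤ v)` of spacing `a' ∈ [a(1 - 1/50), a(1 + 1/50)]`.
[folklore] -/
theorem stub_firstLayer (Z : Set (EuclideanSpace ℝ (Fin 3))) (a : ℝ) (ha : 0 < a) (hne : Z.Nonempty)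
    (hgap : ∀ y ∈ Z, ∀ w ∈ Z, w ≠ y → a * (1 - 1 / 50) ≤ dist y w ∧
      (dist y w ≤ a * (1 + 1 / 50) ∨ a * (63 / 50) ≤ dist y w))
    (hexact : ∀ p ∈ Z, ∃ (a' hp' hm' : ℝ) (A : EuclideanSpace ℝ (Fin 3) →ₗᵢ[ℝ] EuclideanSpace ℝ (Fin 3)),
      0 < a' ∧ 0 < hp' ∧ 0 < hm' ∧
      ((bondShell a Z p = Set.range fun k : Fin 12 => p + A (slotC a' hp' hm' k)) ∨
       (bondShell a Z p = Set.range fun k : Fin 12 => p + A (slotH a' hp' hm' k)))) :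
    ∃ p₀ ∈ Z, ∃ (a' : ℝ) (A : EuclideanSpace ℝ (Fin 3) →ₗᵢ[ℝ] EuclideanSpace ℝ (Fin 3)),
      a * (1 - 1 / 50) ≤ a' ∧ a' ≤ a * (1 + 1 / 50) ∧
      ∀ i j : ℤ, A ((i : ℝ) • triangularVec₁ a' + (j : ℝ) • triangularVec₂ a') + p₀ ∈ Z := by
  -- every site has a representation of some type `t`
  have rep : ∀ y ∈ Z, ∃ (b kp km : ℝ) (B : EuclideanSpace ℝ (Fin 3) →ₗᵢ[ℝ] EuclideanSpace ℝ (Fin 3)) (t : Bool),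
      0 < b ∧ 0 < kp ∧ 0 < km ∧ bondShell a Z y = Set.range fun k : Fin 12 => y + B (laSlot t b kp km k) := by
    intro y hy
    obtain ⟨b, kp, km, B, hb, hkp, hkm, h | h⟩ := hexact y hy
    · exact ⟨b, kp, km, B, true, hb, hkp, hkm, h⟩
    · exact ⟨b, kp, km, B, false, hb, hkp, hkm, h⟩
  have band : ∀ y ∈ Z, ∀ (b kp km : ℝ) (B : EuclideanSpace ℝ (Fin 3) →ₗᵢ[ℝ] EuclideanSpace ℝ (Fin 3)) (t : Bool),
      0 < b → 0 < kp → 0 < km → (bondShell a Z y = Set.range fun k : Fin 12 => y + B (laSlot t b kp km k)) →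
      a * (1 - 1 / 50) ≤ b ∧ b ≤ a * (1 + 1 / 50) := by
    intro y hy b kp km B t hb hkp hkm h
    have h' : (bondShell a Z y = Set.range fun k : Fin 12 => y + B (slotC b kp km k)) ∨
        (bondShell a Z y = Set.range fun k : Fin 12 => y + B (slotH b kp km k)) := by
      cases t
      · exact Or.inr h
      · exact Or.inl h
    obtain ⟨h1, h2, -⟩ := stub_exactBand Z a ha hgap y hy b kp km B hb hkp hkm h'
    exact ⟨h1, h2⟩
  by_cases hrig : ∃ p ∈ Z, ∃ (b kp km : ℝ) (B : EuclideanSpace ℝ (Fin 3) →ₗᵢ[ℝ] EuclideanSpace ℝ (Fin 3)) (t : Bool),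
      0 < b ∧ 0 < kp ∧ 0 < km ∧ (bondShell a Z p = Set.range fun k : Fin 12 => p + B (laSlot t b kp km k)) ∧
      (t = true → ¬ (3 * kp ^ 2 = 2 * b ^ 2 ∧ 3 * km ^ 2 = 2 * b ^ 2))
  · -- a rigid site: walk in its plane with the in-plane step
    obtain ⟨p, hp, b, kp, km, B, t, hb, hkp, hkm, hS, ht⟩ := hrig
    refine ⟨p, hp, b, B, (band p hp b kp km B t hb hkp hkm hS).1, (band p hp b kp km B t hb hkp hkm hS).2, fun i j => ?_⟩
    rw [add_comm]
    exact la_walk Z a b kp km hb t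
      (fun x F hx hFx => inplaneStep_of_type Z a ha hgap hexact x hx b kp km F hb hkp hkm t hFx ht) B p hp hS i j
  · -- every shell is a perfect cuboctahedron: walk with the cuboctahedral step
    push Not at hrig
    have hall : ∀ y ∈ Z, ∃ (b k : ℝ) (B : EuclideanSpace ℝ (Fin 3) →ₗᵢ[ℝ] EuclideanSpace ℝ (Fin 3)),
        0 < b ∧ 0 < k ∧ 3 * k ^ 2 = 2 * b ^ 2 ∧ bondShell a Z y = Set.range fun i : Fin 12 => y + B (slotC b k k i) := by
      intro y hy
      obtain ⟨b, kp, km, B, t, hb, hkp, hkm, h⟩ := rep y hy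
      obtain ⟨rfl, h1, h2⟩ := hrig y hy b kp km B t hb hkp hkm h
      have hkk : kp = km := (pow_left_inj₀ hkp.le hkm.le two_ne_zero).1 (by linarith)
      subst hkk
      exact ⟨b, kp, B, hb, hkp, h1, h⟩
    obtain ⟨p, hp⟩ := hne
    obtain ⟨b, k, B, hb, hk, hid, hS⟩ := hall p hp
    refine ⟨p, hp, b, B, (band p hp b k k B true hb hk hk hS).1, (band p hp b k k B true hb hk hk hS).2, fun i j => ?_⟩
    rw [add_comm]
    exact la_walk Z a b k k hb true (fun x F hx hFx => stub_cuboctStep Z a ha hall x hx b k F hb hk hid hFx) B p hp hS i j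

end Summit.AtomisticToContinuum.Crystallization.Theorems.CleanHull

end
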